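import Literature.AnabelianGeometry.EtaleTheta.Discharge.Sec4Prop42iiiThetaTwistTowerQuotient
import HarnessLib

/-!
# [EtTh] Prop. 4.2 (iii) ∧ (iv) AT THE ROOTS READING — POSITIVE at the fourth tower model: the cyclotomic–Kummer level saturation

S. Mochizuki, *The étale theta function and its Frobenioid-theoretic manifestations*, Publ. RIMS **45** (2009) [MochizukiEtTh2009],
Prop. 4.2 (iii)/(iv) PDF pp.88–90 («if `A` is `(N, H)`-saturated, then the natural action of `Aut(A) → Aut(A_H)` on the roots …»; the field
`K_N ∋ ζ_N` and the `N`-th roots of the constants of `A_⊙`) [cite: MochizukiEtTh2009, Prop 4.2 (iv) p.90]; Def. 3.3 (ii)/(iii) pp.73–74 (the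
levels `N_n = (n+1)!`, `M_n = (n+2)!`, `B₀ = Mero(Z_∞)^{Stab}`); Def. 3.6 p.77 (`B = B₀^Λ ×_{(Φ^ℝlog)^gp} Φ^gp`); [FrdII] Rmk. 2.2.1
(`K(μ_N, (O^×)^{1/N})`) [cite: MochizukiFrdII2008, Rmk. 2.2.1 p.17]; [FrdI] Thm. 5.2 p.100.

## What is proved (sorry-free; the DISCHARGE of abc-iut-w6-d037's `hsatK`)

abc-iut-w6-d037's `ThetaTwistTowerTempered.prop42_iii_iv_rootsReading_of_levelSaturationKummer` (p499861) reduced [EtTh] Prop. 4.2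
(iii) ∧ (iv) AS TYPED, at the ROOTS READING of the `(N, H_⊙^{bs-fld})`-slot, over the fourth tower model `temperedFrobenioid R S`, to ONE
level-wise hypothesis `hsatK K`: a threshold `m(K)` beyond which every object with `χ_m`-trivial stabilisers is `μ_K`-saturated AND every
`Div_B`-trivial rational function of the anchor `A_⊙` becomes a `K`-th power along every base arrow.  Here `hsatK` is PROVED
(`levelSaturationKummer`, threshold `m(K) := lvl(A_⊙) + K`):

* §0 `exists_root_of_upAdd`, `castHom_mul_eq_of_right_eq_one`, `dvd_eN_and_dvd_M` (level arithmetic: `K`-th roots in `ℤ/N_l` killed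
  by `K·N_{n₀} ∣ M_{n₀+K}`; trivial `χ_m` ⇒ trivial action on `M_m`-torsion); §1 `snd_eq_one_of_divΛ_eq_one` (trivial `Λ`-divisor ⇒
  `μ`-VALUED, via `Φ₀ ↪ Φ₀^pf ↪ Φ₀^rlf`, `divZeroHom_eq_one_iff`, `ε = 0`); §2 `exists_muFamily_through` (abc-iut-L2-d2's
  `exists_bZero_of_invariant`), `pow_eq_BZero_map`, the assembly `TemperedFrobenioid.exists_pow_eq_pull_of_divB_eq_one` in
  `B = B₀^Λ × Φ^gp` for ANY tempered Frobenioid, and the Kummer clause `exists_root_of_divB_eq_one`;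
* §3 `levelSaturationKummer` (= `hsatK`; the `μ_K`-half is abc-iut-L2-d2's `levelSaturation` p501418) and the POSITIVE instances
  `prop42_iii_iv_rootsReading` (displayed Def. 4.1 (ii) Galois datum) and `prop42_iii_iv_rootsReading_mkOfQuotientTemperoid` (abc-iut-L2-t3's
  quotient-temperoid setting, datum CONSTRUCTED from a continuous surjection `φ : Π^tp_X ↠ Compat₃′`) — no law-level hypothesis left.

Elaboration note: concrete-model statements go through `ratFnFunctor.obj` / `pull` / `divB` (as in `hsatK`), the component bookkeeping is
done over an ABSTRACT `C`, and `omega` is kept out of proofs holding concrete-model hypotheses (its `whnf` of those carriers times out).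
-/

noncomputable section

namespace Literature.AnabelianGeometry.EtaleTheta

open CategoryTheory Opposite Function Literature.AlgebraicGeometry.Frobenioids Literature.AnabelianGeometry.SemiGraphs
  Literature.AlgebraicGeometry.Frobenioids.QuasiTemperoid LogDivisorModel LogDivisorModel.GaloisAction LogDivisorTower

namespace ThetaTwistTowerTempered

open LogDivisorModel.TateTowerThetaTwist TateTowerKummerTwistRShear
open TateTowerKummerTwist (M Cst N N_dvd_M eN N_mul_eN upAdd upAdd_intCast)

/-! ## §0 Level arithmetic: `K`-th roots of included roots of unity, and the character acting trivially on small-order elements -/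

/-- **A `K`-th root at level `l` of a level-`n₀` root of unity, killed by `K · N_{n₀}`**, whenever `K ∣ e = N_l/N_{n₀}`: for
`v ∈ ℤ/N_{n₀}`, `r := (e/K)·ṽ` has `K • r = ι_{n₀→l}(v)` and `(K · N_{n₀}) • r = 0`. [cite: MochizukiEtTh2009, §1 p.13] -/
theorem exists_root_of_upAdd {n₀ l : ℕ} (h : n₀ ≤ l) {K : ℕ} (hKe : K ∣ eN n₀ l) (v : ZMod (N n₀)) :
    ∃ r : ZMod (N l), K • r = upAdd h v ∧ (K * ((N n₀ : ℕ+) : ℕ)) • r = 0 := by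
  haveI : NeZero ((N n₀ : ℕ+) : ℕ) := ⟨PNat.ne_zero _⟩
  obtain ⟨q, hq⟩ := hKe
  refine ⟨((q * v.val : ℕ) : ZMod (N l)), ?_, ?_⟩
  · have hv : upAdd h v = ((v.val : ℕ) : ZMod (N l)) * ((eN n₀ l : ℕ) : ZMod (N l)) := by
      conv_lhs => rw [← ZMod.natCast_zmod_val v, ← Int.cast_natCast, upAdd_intCast, Int.cast_natCast]
    rw [hv, nsmul_eq_mul, ← Nat.cast_mul, ← Nat.cast_mul, ← mul_assoc, ← hq, Nat.mul_comm]
  · rw [nsmul_eq_mul, ← Nat.cast_mul, ZMod.natCast_eq_zero_iff]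
    refine ⟨v.val, ?_⟩
    calc K * ((N n₀ : ℕ+) : ℕ) * (q * v.val) = (((N n₀ : ℕ+) : ℕ) * (K * q)) * v.val := by ring
      _ = ((N l : ℕ+) : ℕ) * v.val := by rw [← hq, N_mul_eN h]

variable {m n : ℕ} (hmn : m ≤ n)

include hmn in
/-- **An element of «GRP₃′» with trivial index-`m` character coordinate multiplies every `r ∈ ℤ/N_n` killed by `M_m` trivially at
level `n`** (compatibility `c_n ≡ c_m = 1 (mod M_m)`; abc-iut-L2-d2's `castHom_mul_zetaImage_eq` is the case `r = N_n/N_m`).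
[cite: MochizukiEtTh2009, §1 p.13] -/
theorem castHom_mul_eq_of_right_eq_one (g : Compat 3 thetaShear) (hg : (g : Grp 3 thetaShear).right.1 m = 1) (r : ZMod (N n))
    (hr : (M m : ZMod (N n)) * r = 0) :
    ZMod.castHom (N_dvd_M n) (ZMod (N n)) (((g : Grp 3 thetaShear).right.1 n : (ZMod (M n))ˣ) : ZMod (M n)) * r = r := by
  haveI : NeZero (M n) := ⟨Nat.factorial_ne_zero _⟩
  set u : ZMod (M n) := (((g : Grp 3 thetaShear).right.1 n : (ZMod (M n))ˣ) : ZMod (M n)) with hu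
  have hum : (u.val : ZMod (M m)) = 1 := by
    have h := congrArg (fun x : (ZMod (M m))ˣ => (x : ZMod (M m))) (resC_right_eq 3 thetaShear g hmn)
    simp only [hg, Units.val_one, Units.coe_map, RingHom.toMonoidHom_eq_coe, MonoidHom.coe_coe] at h
    rw [← map_natCast (TateTowerKummerTwist.res hmn) u.val, ZMod.natCast_zmod_val]
    exact h
  have hM1 : M m ≠ 1 := Nat.ne_of_gt (Nat.one_lt_factorial.mpr (by omega))
  have hmod : u.val % M m = 1 := by
    have h := (ZMod.natCast_eq_natCast_iff' u.val 1 (M m)).mp (by rw [hum, Nat.cast_one])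
    rwa [Nat.one_mod_eq_one.mpr hM1] at h
  have hdecomp : u.val = M m * (u.val / M m) + 1 := by
    conv_lhs => rw [← Nat.div_add_mod u.val (M m), hmod]
  rw [← ZMod.natCast_zmod_val u, map_natCast, hdecomp, Nat.cast_add, Nat.cast_mul, Nat.cast_one, add_mul, one_mul,
    mul_comm (M m : ZMod (N n)), mul_assoc, hr, mul_zero, zero_add]

/-! ## §1 At the fourth model: a rational function with trivial `Λ`-divisor is a `μ`-valued constant family -/

/-- **`Ker(B₀(Y) → (Φ₀^ℝ)^gp) ⊆ μ`-valued families** at the ε-free theta tower (Prop. 3.2 (ii)/(iii) + Prop. 3.4 (ii) at the level):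
`divΛ b = 1` ⇒ `div₀ b = 1` (effectivity is detected in `Φ₀`, `Φ₀ → Φ₀^rlf` injective; abc-iut-w6-d058's route) ⇒ every value of `b` is
a unit integral constant (`divZeroHom_eq_one_iff`) ⇒ its skeleton exponents vanish (`ε = 0` on the sign-free tower).
[cite: MochizukiEtTh2009, Prop 3.4 p.74] -/
theorem snd_eq_one_of_divΛ_eq_one (Y : ConnectedPart (BTemp (Compat 3 thetaShear))) (b : dm.B₀.obj (op Y))
    (hb : (RealifiedDivisorMonoids.ofRlfZWeak dm hpf).divΛ (op Y) b = 1) (s : (gset Y).V) : (b.1 s).1.2 = 1 := by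
  have hP := (hpf (op Y)).weak
  have h1 : (RealifiedDivisorMonoids.ofRlfZWeak dm hpf).divΛ (op Y) b = Algebra.GrothendieckGroup.of 1 := by rw [hb, map_one]
  obtain ⟨x₀, hx₀, hx₁⟩ := RlfEffective.exists_eq_of_weak hP (dm.div₀ (op Y) b) 1 h1
  have hx₀1 : x₀ = 1 := by
    have h2 : Perfection.of _ x₀ = 1 :=
      (fun a c (h : hP.toRealification a = hP.toRealification c) => hP.factorMap_injective (congrArg Subtype.val h))
        _ _ (by rw [map_one]; exact hx₁.symm)
    exact of_injective_of_isSharp_isIntegral_isSaturated hP.isDivisorial.isSharp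
      hP.isDivisorial.isPreDivisorial.isIntegral hP.isDivisorial.isPreDivisorial.isSaturated (by rw [h2, map_one])
  rw [hx₀1, map_one] at hx₀
  -- `div₀ b = 1` at the level: every value is a unit integral constant
  have hint := ((towerC₃sf.act (lvlC 3 thetaShear Y)).divZeroHom_eq_one_iff (gset Y) b).1 hx₀ s
  -- read the exponents: `0 ≤ eC`, `0 ≤ -eC`, `eU = eT = 0`, and `ε = 0` on the sign-free tower
  obtain ⟨⟨hC, hU, hT⟩, ⟨hC', -, -⟩⟩ := hint
  have hε := fst_eq_zero_of_towerC₃sf (lvlC 3 thetaShear Y) (b.1 s)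
  change 0 ≤ TateTowerTheta.eC (Multiplicative.toAdd (b.1 s).1.2) at hC
  have hC'' : 0 ≤ -TateTowerTheta.eC (Multiplicative.toAdd (b.1 s).1.2) := hC'
  refine Multiplicative.toAdd.injective (TateTowerTheta.ext_exp hε ?_ hU hT)
  change TateTowerTheta.eC (Multiplicative.toAdd (b.1 s).1.2) = 0
  exact le_antisymm (neg_nonneg.mp hC'') hC

/-! ## §2 The Kummer clause at the fourth model: roots of `A_⊙`'s `Div_B`-trivial rational functions over the deep coverings -/

/-- The threshold `m := n₀ + K`: `K ∣ N_l / N_{n₀}` for `n₀ + K ≤ l`, and `K · N_{n₀} ∣ M_{n₀+K}`. [cite: MochizukiEtTh2009, Def 3.3 (ii) p.73] -/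
theorem dvd_eN_and_dvd_M {n₀ K l : ℕ} (hK : 0 < K) (hl : n₀ + K ≤ l) :
    K ∣ eN n₀ l ∧ K * ((N n₀ : ℕ+) : ℕ) ∣ M (n₀ + K) := by
  constructor
  · have h1 : ((N n₀ : ℕ+) : ℕ) * K.factorial ∣ ((N n₀ : ℕ+) : ℕ) * eN n₀ l := by
      rw [N_mul_eN (show n₀ ≤ l by omega), TateTowerKummerTwist.coe_N, TateTowerKummerTwist.coe_N]
      exact (Nat.factorial_mul_factorial_dvd_factorial_add (n₀ + 1) K).trans (Nat.factorial_dvd_factorial (by omega))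
    exact (Nat.dvd_factorial hK le_rfl).trans (Nat.dvd_of_mul_dvd_mul_left (PNat.pos _) h1)
  · have h1 : (n₀ + 1).factorial * (K + 1).factorial ∣ (n₀ + 1 + (K + 1)).factorial :=
      Nat.factorial_mul_factorial_dvd_factorial_add (n₀ + 1) (K + 1)
    have h2 : K ∣ (K + 1).factorial := Nat.dvd_factorial hK (Nat.le_succ K)
    have h3 : M (n₀ + K) = (n₀ + 1 + (K + 1)).factorial := by
      rw [show n₀ + 1 + (K + 1) = n₀ + K + 2 by omega]
    rw [h3, mul_comm]
    exact (Nat.mul_dvd_mul_left _ h2).trans h1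

section Level

variable {n₀ l : ℕ} (hn₀l : n₀ ≤ l) {S : Action (Type 0) (Compat 3 thetaShear)}

/-- The level transition keeps `μ`-valuedness (the skeleton exponents are multiplied by the ramification index).
[cite: MochizukiEtTh2009, Def 3.3 (iii) p.74] -/
theorem resFn_snd_eq_one (x : (towerC₃sf.Z n₀).Fn) (hx : x.1.2 = 1) :
    (resFn (upAdd hn₀l) (eN n₀ l) x.1).2 = 1 := by
  rw [resFn_apply]
  change Multiplicative.ofAdd (resExp (eN n₀ l) (Multiplicative.toAdd x.1.2)) = 1
  have h1 : (Multiplicative.toAdd (1 : TateTowerTheta.model.Fn) : TateTowerTheta.Exp) = 0 := rfl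
  rw [hx, h1, map_zero]
  rfl

/-- **A `μ`-valued equivariant family through a prescribed stabiliser-fixed root of unity** (abc-iut-L2-d2's `exists_bZero_of_invariant` +
(M2)): if `χ_m(Stab s₀) = 1`, `m ≤ l`, and `r ∈ ℤ/N_l` is killed by `M_m`, there is `ζ₀ ∈ B₀(S)`, `μ`-valued, with `ζ₀(s₀) = (r, 1)`.
[cite: MochizukiEtTh2009, Def 3.3 (iii) p.73] -/
theorem exists_muFamily_through {m : ℕ} (hml : m ≤ l) (hS : isConnectedGSet S) (s₀ : S.V)
    (hχ : ∀ g : Compat 3 thetaShear, S.ρ g s₀ = s₀ → (g : Grp 3 thetaShear).right.1 m = 1)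
    (r : ZMod (N l)) (hrM : (M m : ZMod (N l)) * r = 0) :
    ∃ ζ₀ : (towerC₃sf.act l).bZero S, (∀ s, (ζ₀.1 s).1.2 = 1) ∧ (ζ₀.1 s₀).1.1 = Multiplicative.ofAdd r := by
  let f₀ : (towerC₃sf.Z l).Fn := ⟨zeta (TateTowerKummerTwist.MuN l) (Multiplicative.ofAdd r), rfl⟩
  have hf₀ : f₀.1.2 = 1 := rfl
  have hinv : ∀ g : Compat 3 thetaShear, S.ρ g s₀ = s₀ → (towerC₃sf.act l).actFn g f₀ = f₀ := by
    intro g hg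
    refine Subtype.ext ?_
    rw [actFn_fst_of_snd_eq_one _ g f₀ hf₀]
    refine Prod.ext ?_ rfl
    change levelCharMod l (N l) (N_dvd_M l) (g : Grp 3 thetaShear).right.1 (Multiplicative.ofAdd r) = Multiplicative.ofAdd r
    rw [levelCharMod_apply, toAdd_ofAdd, castHom_mul_eq_of_right_eq_one hml g (hχ g hg) r hrM]
  obtain ⟨ζ₀, hζ₀⟩ := (towerC₃sf.act l).exists_bZero_of_invariant hS s₀ (f := f₀) trivial hinv
  have hζμ : ∀ s, (ζ₀.1 s).1.2 = 1 := fun s => by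
    obtain ⟨g, rfl⟩ := hS.2 s₀ s
    rw [ζ₀.2.2 g s₀, hζ₀]
    exact actFn_snd_eq_one _ g _ hf₀
  refine ⟨ζ₀, hζμ, ?_⟩
  rw [hζ₀]
  rfl

/-- Powers of a `μ`-valued family: `μ`-valued, `μ`-coordinate the power (`ℕ`-form of `zpow_apply_fst`). [cite: MochizukiEtTh2009, §1 p.13] -/
theorem pow_apply_fst {ζ₀ : (towerC₃sf.act l).bZero S} (hζ : ∀ s, (ζ₀.1 s).1.2 = 1) (k : ℕ) (s : S.V) :
    ((ζ₀ ^ k).1 s).1.1 = (ζ₀.1 s).1.1 ^ k ∧ ((ζ₀ ^ k).1 s).1.2 = 1 := by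
  constructor
  · rfl
  · change (ζ₀.1 s).1.2 ^ k = 1
    rw [hζ s, one_pow]

end Level

/-- **The `K`-th power of a root family is the pulled-back family**: over `b : Y → Y₀` (levels `n₀ ≤ l`), a `μ`-valued `ζ₀ ∈ B₀(Y)` with
`ζ₀(s₀) = r`, `K • r = ι(b₀(b s₀))`, has `ζ₀ ^ K = B₀(b)(b₀)` for every `μ`-valued `b₀ ∈ B₀(Y₀)` (two `μ`-valued families agreeing at one
point of the connected `Y`). [cite: MochizukiEtTh2009, Def 3.3 (iii) p.74] -/
theorem pow_eq_BZero_map {K : ℕ} {Y₀ Y : ConnectedPart (BTemp (Compat 3 thetaShear))} (b : Y ⟶ Y₀)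
    (hn₀l : lvlC 3 thetaShear Y₀ ≤ lvlC 3 thetaShear Y) (s₀ : Y.obj.obj.V) (b₀ : dm.B₀.obj (op Y₀)) (hμ : ∀ s, (b₀.1 s).1.2 = 1)
    (ζ₀ : (towerC₃sf.act (lvlC 3 thetaShear Y)).bZero (gset Y)) (hζμ : ∀ s, (ζ₀.1 s).1.2 = 1) (r : ZMod (N (lvlC 3 thetaShear Y)))
    (hζ₀ : (ζ₀.1 s₀).1.1 = Multiplicative.ofAdd r)
    (hKr : K • r = upAdd hn₀l (Multiplicative.toAdd (b₀.1 (b.hom.hom.hom s₀)).1.1)) :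
    ζ₀ ^ K = (dm.B₀.map b.op).hom b₀ := by
  refine eq_of_snd_eq_one_of_fst_eq _ (isConnectedGSet_gset Y) s₀ (fun s => (pow_apply_fst hζμ K s).2) (fun s => ?_) ?_
  · change (resFn (upAdd hn₀l) (eN (lvlC 3 thetaShear Y₀) (lvlC 3 thetaShear Y)) (b₀.1 (b.hom.hom.hom s)).1).2 = 1
    exact resFn_snd_eq_one hn₀l _ (hμ _)
  · rw [(pow_apply_fst hζμ K s₀).1, hζ₀]
    change Multiplicative.ofAdd r ^ K = Multiplicative.ofAdd (upAdd hn₀l (Multiplicative.toAdd (b₀.1 (b.hom.hom.hom s₀)).1.1))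
    rw [← ofAdd_nsmul, hKr]

/-- **`μ`-valued families have trivial `Λ`-divisor** (`div₀ = 1`, Prop. 3.4 (ii), pushed to `(Φ₀^rlf)^gp`).
[cite: MochizukiEtTh2009, Prop 3.4 p.74] -/
theorem divΛ_eq_one_of_snd_eq_one (Y : ConnectedPart (BTemp (Compat 3 thetaShear)))
    (ζ₀ : (towerC₃sf.act (lvlC 3 thetaShear Y)).bZero (gset Y)) (hζμ : ∀ s, (ζ₀.1 s).1.2 = 1) :
    (RealifiedDivisorMonoids.ofRlfZWeak dm hpf).divΛ (op Y) ζ₀ = 1 := by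
  rw [RealifiedDivisorMonoids.ofRlfZWeak_divΛ_apply]
  have h0 : dm.div₀ (op Y) ζ₀ = 1 := divZeroHom_eq_one_of_snd_eq_one _ hζμ
  rw [h0]
  exact map_one _

end ThetaTwistTowerTempered

/-! ### Assembly in `B(A) = B₀^Λ ×_{(Φ^ℝlog)^gp} Φ^gp` (any tempered Frobenioid) -/

namespace TemperedFrobenioid

universe u₀ v₀ u v w

variable {D₀ : Type u₀} [Category.{v₀} D₀] {V : FrdIMonoidStub.{w}}
  {T : RealifiedDivisorMonoids (D₀ := D₀) V} {D : Type u} [Category.{v} D]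
  {VD : FrdICatStub.{u, v, w} D} (C : TemperedFrobenioid T D VD)

/-- **Assembly in `B(A') = B₀^Λ ×_{(Φ^ℝlog)^gp} Φ^gp`**: a `ζ₀ ∈ B₀^Λ(A'^bs)` with trivial `Λ`-divisor and
`ζ₀ ^ K = B₀^Λ(f)(x_{B₀})` gives the `K`-th root `ζ := (ζ₀, 1) ∈ B(A')` of the pull-back along `f` of a rational function
`x = (x_{B₀}, 1)` of `A` with trivial `Φ^gp`-component. [cite: MochizukiEtTh2009, Def 3.6 p.77] -/
theorem exists_ratFn_pow_eq_ratFnPull {A A' : Dᵒᵖ} (f : A ⟶ A') {K : ℕ} (x : C.ratFn A) (hx : x.1.2 = 1)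
    (ζ₀ : T.BΛ.obj (C.baseOp A')) (hζ : T.divΛ (C.baseOp A') ζ₀ = 1)
    (hpow : ζ₀ ^ K = (T.BΛ.map (C.base.map f.unop).op).hom x.1.1) :
    ∃ ζ : C.ratFn A', ζ ^ K = C.ratFnPull f x := by
  have hmem : (ζ₀, (1 : Algebra.GrothendieckGroup (C.Φ.carrier A'))) ∈ C.ratFn A' := by
    change T.divΛ (C.baseOp A') ζ₀ = C.ΦgpToRlog A' 1
    rw [hζ, map_one]
  refine ⟨⟨(ζ₀, 1), hmem⟩, Subtype.ext (Prod.ext hpow ?_)⟩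
  change (1 : Algebra.GrothendieckGroup (C.Φ.carrier A')) ^ K = gpMap (C.Φ.pull f) x.1.2
  rw [hx, map_one, one_pow]

/-- A rational function with `Div_B = 1` has `B₀^Λ`-component with trivial `Λ`-divisor (the defining equation of
`B = B₀^Λ ×_{(Φ^ℝlog)^gp} Φ^gp`). [cite: MochizukiEtTh2009, Def 3.6 p.77] -/
theorem divΛ_fst_eq_one_of_divB_eq_one (A : Dᵒᵖ) (x : C.ratFnFunctor.obj A)
    (hx : Literature.AlgebraicGeometry.Frobenioids.divB C.divisorMonoid C.ratFnFunctor C.divBNatTrans A x = 1) :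
    T.divΛ (C.baseOp A) (Subtype.val x).1 = 1 := by
  have h : T.divΛ (C.baseOp A) (Subtype.val x).1 = C.ΦgpToRlog A
      (Literature.AlgebraicGeometry.Frobenioids.divB C.divisorMonoid C.ratFnFunctor C.divBNatTrans A x) := x.2
  rw [hx] at h
  exact h.trans (map_one (C.ΦgpToRlog A))

/-- **`K`-th roots of pull-backs from a `B₀^Λ`-root** (functorial form of `exists_ratFn_pow_eq_ratFnPull`): for `f : A' → A`,
`x ∈ B(A)` with `Div_B x = 1`, and `ζ₀ ∈ B₀^Λ(A'^bs)` with trivial `Λ`-divisor and `ζ₀ ^ K = B₀^Λ(f)(x_{B₀})`, the pull-back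
`f^* x` is a `K`-th power in `B(A')`. [cite: MochizukiEtTh2009, Def 3.6 p.77] -/
theorem exists_pow_eq_pull_of_divB_eq_one {A A' : D} (f : A' ⟶ A) {K : ℕ} (x : C.ratFnFunctor.obj (op A))
    (hx : Literature.AlgebraicGeometry.Frobenioids.divB C.divisorMonoid C.ratFnFunctor C.divBNatTrans (op A) x = 1)
    (ζ₀ : T.BΛ.obj (C.baseOp (op A'))) (hζ : T.divΛ (C.baseOp (op A')) ζ₀ = 1)
    (hpow : ζ₀ ^ K = (T.BΛ.map (C.base.map f).op).hom (Subtype.val x).1) :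
    ∃ ζ : C.ratFnFunctor.obj (op A'), ζ ^ K = pull C.ratFnFunctor f x :=
  C.exists_ratFn_pow_eq_ratFnPull f.op x hx ζ₀ hζ hpow

end TemperedFrobenioid

namespace ThetaTwistTowerTempered

open LogDivisorModel.TateTowerThetaTwist TateTowerKummerTwistRShear
open TateTowerKummerTwist (M Cst N N_dvd_M eN N_mul_eN upAdd upAdd_intCast)

variable (R S : ((ConnectedPart (BTemp (Compat 3 thetaShear)))ᵒᵖ ⥤ CommMonCat.{0}) → Prop)

/-- **The Kummer clause of the roots reading at the fourth model.**  Over every covering `b : Y → Y₀` of level `l ≥ lvl(Y₀) + K` whose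
stabilisers have trivial `χ_{lvl(Y₀)+K}`, every `Div_B`-trivial rational function `x` of `Y₀` (a `μ`-valued constant family, §1) becomes a
`K`-th power: its values have `K`-th roots in `μ_{N_l}` killed by `M_{lvl(Y₀)+K}`, hence FIXED by the stabilisers (§0), so they assemble into
an equivariant family (§2) — print's «`K_N ∋ ζ_N` and the `N`-th roots of the constants». [cite: MochizukiEtTh2009, Prop 4.2 (iv) p.90] -/
theorem exists_root_of_divB_eq_one {K : ℕ} (hK : 0 < K) (Y₀ Y : ConnectedPart (BTemp (Compat 3 thetaShear)))
    (hl : lvlC 3 thetaShear Y₀ + K ≤ lvlC 3 thetaShear Y)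
    (hχ : ∀ (s : Y.obj.obj.V) (g : Compat 3 thetaShear), Y.obj.obj.ρ g s = s →
      (g : Grp 3 thetaShear).right.1 (lvlC 3 thetaShear Y₀ + K) = 1)
    (b : Y ⟶ Y₀) (x : (ThetaTwistTowerTempered.temperedFrobenioid R S).ratFnFunctor.obj (op Y₀))
    (hx : Literature.AlgebraicGeometry.Frobenioids.divB (ThetaTwistTowerTempered.temperedFrobenioid R S).divisorMonoid
      (ThetaTwistTowerTempered.temperedFrobenioid R S).ratFnFunctor
      (ThetaTwistTowerTempered.temperedFrobenioid R S).divBNatTrans (op Y₀) x = 1) :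
    ∃ ζ : (ThetaTwistTowerTempered.temperedFrobenioid R S).ratFnFunctor.obj (op Y),
      ζ ^ K = pull (ThetaTwistTowerTempered.temperedFrobenioid R S).ratFnFunctor b x := by
  -- (no `omega` / context-scanning tactic here: they `whnf` the concrete fourth-model carrier types and time out)
  have hn₀l : lvlC 3 thetaShear Y₀ ≤ lvlC 3 thetaShear Y := le_trans (Nat.le_add_right _ K) hl
  obtain ⟨hKe, hKM⟩ := dvd_eN_and_dvd_M (n₀ := lvlC 3 thetaShear Y₀) (l := lvlC 3 thetaShear Y) hK hl
  obtain ⟨s₀⟩ := BTempConnected.nonempty_of_isConnectedObj Y.obj Y.property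
  -- the `B₀`-component of `x` is `μ`-valued (`divΛ x₁ = 1`, §1)
  have hdiv : (RealifiedDivisorMonoids.ofRlfZWeak dm hpf).divΛ (op Y₀) (Subtype.val x).1 = 1 :=
    (ThetaTwistTowerTempered.temperedFrobenioid R S).divΛ_fst_eq_one_of_divB_eq_one (op Y₀) x hx
  have hμ : ∀ s, ((Subtype.val x).1.1 s).1.2 = 1 := snd_eq_one_of_divΛ_eq_one Y₀ (Subtype.val x).1 hdiv
  -- the root value at `s₀`, killed by `M_{n₀+K}`, and the `μ`-valued family through it
  obtain ⟨r, hKr, hr0⟩ :=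
    exists_root_of_upAdd hn₀l hKe (Multiplicative.toAdd ((Subtype.val x).1.1 (b.hom.hom.hom s₀)).1.1)
  have hrM : (M (lvlC 3 thetaShear Y₀ + K) : ZMod (N (lvlC 3 thetaShear Y))) * r = 0 := by
    obtain ⟨t, ht⟩ := hKM
    rw [ht, Nat.cast_mul (K * _) t, mul_right_comm, ← nsmul_eq_mul, hr0, zero_mul]
  obtain ⟨ζ₀, hζμ, hζ₀⟩ := exists_muFamily_through hl (isConnectedGSet_gset Y) s₀ (fun g hg => hχ s₀ g hg) r hrM
  exact (ThetaTwistTowerTempered.temperedFrobenioid R S).exists_pow_eq_pull_of_divB_eq_one b x hx ζ₀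
    (divΛ_eq_one_of_snd_eq_one Y ζ₀ hζμ) (pow_eq_BZero_map b hn₀l s₀ (Subtype.val x).1 hμ ζ₀ hζμ r hζ₀ hKr)

/-! ## §3 The discharge: the level-wise CYCLOTOMIC–KUMMER saturation `hsatK`, and [EtTh] Prop. 4.2 (iii) ∧ (iv) at the ROOTS READING -/

/-- **The cyclotomic–Kummer level saturation `hsatK` of abc-iut-w6-d037's `prop42_iii_iv_rootsReading_of_levelSaturationKummer` HOLDS at
the fourth model** (threshold `m(K) := lvl(A_⊙) + K`): beyond it, every object with `χ_m`-trivial stabilisers is `μ_K`-saturated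
(abc-iut-L2-d2's `levelSaturation`, `K ∣ N_m = (m+1)!`) AND every `Div_B`-trivial rational function of `A_⊙` becomes a `K`-th power along
every base arrow (§2) — print's «`K_N = K(ζ_N, …)`», [FrdII] Rmk. 2.2.1's `K(μ_N, (O_K^×)^{1/N})`. [cite: MochizukiEtTh2009, Prop 4.2 (iv) p.90] -/
theorem levelSaturationKummer (A₀ : (ThetaTwistTowerTempered.temperedFrobenioid R S).category) (K : ℕ+) :
    ∃ m : ℕ, ∀ A : (ThetaTwistTowerTempered.temperedFrobenioid R S).category, m ≤ lvlC 3 thetaShear A.base →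
      (∀ (s : A.base.obj.obj.V) (g : Compat 3 thetaShear), A.base.obj.obj.ρ g s = s → (g : Grp 3 thetaShear).right.1 m = 1) →
        (ThetaTwistTowerTempered.temperedFrobenioid R S).IsMuSaturated A K ∧
          ∀ (b : A.base ⟶ A₀.base) (x : (ThetaTwistTowerTempered.temperedFrobenioid R S).ratFnFunctor.obj (op A₀.base)),
            Literature.AlgebraicGeometry.Frobenioids.divB (ThetaTwistTowerTempered.temperedFrobenioid R S).divisorMonoid
                (ThetaTwistTowerTempered.temperedFrobenioid R S).ratFnFunctor
                (ThetaTwistTowerTempered.temperedFrobenioid R S).divBNatTrans (op A₀.base) x = 1 →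
              ∃ ζ : (ThetaTwistTowerTempered.temperedFrobenioid R S).ratFnFunctor.obj (op A.base),
                ζ ^ (K : ℕ) = pull (ThetaTwistTowerTempered.temperedFrobenioid R S).ratFnFunctor b x :=
  ⟨lvlC 3 thetaShear A₀.base + K, fun A hm hχ =>
    ⟨levelSaturation R S K _ A (Nat.dvd_factorial K.pos (Nat.le_succ_of_le (Nat.le_add_left (K : ℕ) _))) hm hχ,
      fun b x hx => exists_root_of_divB_eq_one R S K.pos A₀.base A.base hm hχ b x hx⟩⟩

variable {K : Type 1} [Field K] (X : SemiGraphs.TemperedArithmeticGroup.{1} K)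
  (gS : ∀ A : ConnectedPart (BTemp (Compat 3 thetaShear)),
    IsGaloisObj ((ThetaTwistTowerTempered.temperedFrobenioid R S).base.obj A).obj → (X.Pi →* Aut A))
  (gSs : ∀ (A : ConnectedPart (BTemp (Compat 3 thetaShear)))
    (h : IsGaloisObj ((ThetaTwistTowerTempered.temperedFrobenioid R S).base.obj A).obj), Function.Surjective (gS A h))
  (A₀ : (ThetaTwistTowerTempered.temperedFrobenioid R S).category)
  (hA₀ : PreFrobenioid.IsFrobeniusTrivial (ThetaTwistTowerTempered.temperedFrobenioid R S).toElem A₀)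
  (hA₀' : IsGaloisObj ((ThetaTwistTowerTempered.temperedFrobenioid R S).base.obj A₀.base).obj)

/-- **[EtTh] Prop. 4.2 (iii) ∧ (iv) AS TYPED at the fourth model AT THE ROOTS READING of the `(N, H_⊙^{bs-fld})`-slot — POSITIVE**, the
only displayed input the Def. 4.1 (ii) Galois datum `gS`/`gSs` with its naturality `hS` (abc-iut-w6-d037's frame
`prop42_iii_iv_rootsReading_of_levelSaturationKummer` p499861 + `levelSaturationKummer`): over the Frobenius-trivial Galois anchor `A_⊙`,
(iii) every fraction pair has `N`-th roots after an `(N, H_⊙)`-admissible covering, and (iv) the roots reading — every `Div_B`-trivial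
rational function of `A_⊙` acquires its `N`-th roots. [cite: MochizukiEtTh2009, Prop 4.2 p.88] -/
theorem prop42_iii_iv_rootsReading
    (hS : ∀ ⦃A B : ConnectedPart (BTemp (Compat 3 thetaShear))⦄
      (hA : IsGaloisObj ((ThetaTwistTowerTempered.temperedFrobenioid R S).base.obj A).obj)
      (hB : IsGaloisObj ((ThetaTwistTowerTempered.temperedFrobenioid R S).base.obj B).obj) (b : B ⟶ A),
      ∃ c : X.Pi, ∀ g : X.Pi, (gS B hB g).hom ≫ b = b ≫ (gS A hA (c * g * c⁻¹)).hom) :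
    (BiKummerSetting.mkOfModelCanonical X (ThetaTwistTowerTempered.temperedFrobenioid R S) (monoidType_eq R S) (hP R S)
        (fun A => IsGaloisObj ((ThetaTwistTowerTempered.temperedFrobenioid R S).base.obj A).obj) gS gSs
        (fun _ A M => ∀ (b : A.base ⟶ A₀.base) (x : (ThetaTwistTowerTempered.temperedFrobenioid R S).ratFnFunctor.obj (op A₀.base)),
          Literature.AlgebraicGeometry.Frobenioids.divB (ThetaTwistTowerTempered.temperedFrobenioid R S).divisorMonoid
              (ThetaTwistTowerTempered.temperedFrobenioid R S).ratFnFunctor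
              (ThetaTwistTowerTempered.temperedFrobenioid R S).divBNatTrans (op A₀.base) x = 1 →
            ∃ ζ : (ThetaTwistTowerTempered.temperedFrobenioid R S).ratFnFunctor.obj (op A.base),
              ζ ^ (M : ℕ) = pull (ThetaTwistTowerTempered.temperedFrobenioid R S).ratFnFunctor b x)
        A₀ hA₀ hA₀').Prop42_iii
      (fun {_ _} φ x => (ThetaTwistTowerTempered.temperedFrobenioid R S).pullFracModel φ x) ∧
    (BiKummerSetting.mkOfModelCanonical X (ThetaTwistTowerTempered.temperedFrobenioid R S) (monoidType_eq R S) (hP R S)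
        (fun A => IsGaloisObj ((ThetaTwistTowerTempered.temperedFrobenioid R S).base.obj A).obj) gS gSs
        (fun _ A M => ∀ (b : A.base ⟶ A₀.base) (x : (ThetaTwistTowerTempered.temperedFrobenioid R S).ratFnFunctor.obj (op A₀.base)),
          Literature.AlgebraicGeometry.Frobenioids.divB (ThetaTwistTowerTempered.temperedFrobenioid R S).divisorMonoid
              (ThetaTwistTowerTempered.temperedFrobenioid R S).ratFnFunctor
              (ThetaTwistTowerTempered.temperedFrobenioid R S).divBNatTrans (op A₀.base) x = 1 →
            ∃ ζ : (ThetaTwistTowerTempered.temperedFrobenioid R S).ratFnFunctor.obj (op A.base),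
              ζ ^ (M : ℕ) = pull (ThetaTwistTowerTempered.temperedFrobenioid R S).ratFnFunctor b x)
        A₀ hA₀ hA₀').Prop42_iv
      (fun φ x => (ThetaTwistTowerTempered.temperedFrobenioid R S).pullFracModel φ x) :=
  prop42_iii_iv_rootsReading_of_levelSaturationKummer R S X gS gSs A₀ hA₀ hA₀' (levelSaturationKummer R S A₀) hS

omit gS gSs in
/-- **[EtTh] Prop. 4.2 (iii) ∧ (iv) AT THE ROOTS READING — POSITIVE over abc-iut-L2-t3's QUOTIENT-TEMPEROID §4 setting**: for every
vocabulary `R S`, tempered arithmetic group `X`, continuous SURJECTION `φ : Π^tp_X ↠ Compat₃′` and Frobenius-trivial Galois anchor `A_⊙`,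
with the Galois surjections `galoisSurjOf⁰ ∘ φ` (naturality PROVED, abc-iut-L2-t3) and the ROOTS-READING `(N, H)`-slot — no law-level
hypothesis and no displayed datum. [cite: MochizukiEtTh2009, Prop 4.2 p.88] -/
theorem prop42_iii_iv_rootsReading_mkOfQuotientTemperoid (φ : X.Pi →ₜ* Compat 3 thetaShear) (hφ : Function.Surjective φ) :
    (BiKummerSetting.mkOfQuotientTemperoid X (isTemperedC 3 thetaShear) φ hφ (ThetaTwistTowerTempered.temperedFrobenioid R S)
        (monoidType_eq R S) (hP R S)
        (fun _ A M => ∀ (b : A.base ⟶ A₀.base) (x : (ThetaTwistTowerTempered.temperedFrobenioid R S).ratFnFunctor.obj (op A₀.base)),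
          Literature.AlgebraicGeometry.Frobenioids.divB (ThetaTwistTowerTempered.temperedFrobenioid R S).divisorMonoid
              (ThetaTwistTowerTempered.temperedFrobenioid R S).ratFnFunctor
              (ThetaTwistTowerTempered.temperedFrobenioid R S).divBNatTrans (op A₀.base) x = 1 →
            ∃ ζ : (ThetaTwistTowerTempered.temperedFrobenioid R S).ratFnFunctor.obj (op A.base),
              ζ ^ (M : ℕ) = pull (ThetaTwistTowerTempered.temperedFrobenioid R S).ratFnFunctor b x)
        A₀ hA₀ hA₀').Prop42_iii
      (fun {_ _} ψ x => (ThetaTwistTowerTempered.temperedFrobenioid R S).pullFracModel ψ x) ∧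
    (BiKummerSetting.mkOfQuotientTemperoid X (isTemperedC 3 thetaShear) φ hφ (ThetaTwistTowerTempered.temperedFrobenioid R S)
        (monoidType_eq R S) (hP R S)
        (fun _ A M => ∀ (b : A.base ⟶ A₀.base) (x : (ThetaTwistTowerTempered.temperedFrobenioid R S).ratFnFunctor.obj (op A₀.base)),
          Literature.AlgebraicGeometry.Frobenioids.divB (ThetaTwistTowerTempered.temperedFrobenioid R S).divisorMonoid
              (ThetaTwistTowerTempered.temperedFrobenioid R S).ratFnFunctor
              (ThetaTwistTowerTempered.temperedFrobenioid R S).divBNatTrans (op A₀.base) x = 1 →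
            ∃ ζ : (ThetaTwistTowerTempered.temperedFrobenioid R S).ratFnFunctor.obj (op A.base),
              ζ ^ (M : ℕ) = pull (ThetaTwistTowerTempered.temperedFrobenioid R S).ratFnFunctor b x)
        A₀ hA₀ hA₀').Prop42_iv
      (fun ψ x => (ThetaTwistTowerTempered.temperedFrobenioid R S).pullFracModel ψ x) :=
  prop42_iii_iv_rootsReading R S X _ _ A₀ hA₀ hA₀'
    (BiKummerSetting.mkOfQuotientTemperoid_galoisSurj_natural X (isTemperedC 3 thetaShear) φ hφ
      (ThetaTwistTowerTempered.temperedFrobenioid R S) (monoidType_eq R S) (hP R S)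
      (fun _ A M => ∀ (b : A.base ⟶ A₀.base) (x : (ThetaTwistTowerTempered.temperedFrobenioid R S).ratFnFunctor.obj (op A₀.base)),
        Literature.AlgebraicGeometry.Frobenioids.divB (ThetaTwistTowerTempered.temperedFrobenioid R S).divisorMonoid
            (ThetaTwistTowerTempered.temperedFrobenioid R S).ratFnFunctor
            (ThetaTwistTowerTempered.temperedFrobenioid R S).divBNatTrans (op A₀.base) x = 1 →
          ∃ ζ : (ThetaTwistTowerTempered.temperedFrobenioid R S).ratFnFunctor.obj (op A.base),
            ζ ^ (M : ℕ) = pull (ThetaTwistTowerTempered.temperedFrobenioid R S).ratFnFunctor b x)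
      A₀ hA₀ hA₀')

end ThetaTwistTowerTempered

end Literature.AnabelianGeometry.EtaleTheta

end
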